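import Mathlib
import HarnessLib
import Summits.ValiantsHypothesis.ValiantsHypothesis.Theses.MonotoneRestoration
import Literature.Computability.AlgebraicComplexity.ArithCircuit
import Literature.Computability.AlgebraicComplexity.ArithCircuitProofs
import Literature.Computability.AlgebraicComplexity.MonotoneStructure
import Literature.Computability.AlgebraicComplexity.PermanentIrreducible
import Literature.ModelTheory.FiniteModelTheory.CkEquiv
import Summits.ValiantsHypothesis.ValiantsHypothesis.Theorems.MonotoneRestorationMonotoneRestorationQPCosetCount
import Summits.ValiantsHypothesis.ValiantsHypothesis.Theorems.MonotoneRestorationMonotoneRestorationQPSymmetricLB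
import Summits.ValiantsHypothesis.ValiantsHypothesis.Theorems.MonotoneRestorationMonotoneRestorationQPSupportSymmetrisation
import Summits.ValiantsHypothesis.ValiantsHypothesis.Theorems.MonotoneRestorationMonotoneRestorationQPSparseRegime
import Summits.ValiantsHypothesis.ValiantsHypothesis.Theorems.MonotoneRestorationMonotoneRestorationQPBeta
import Literature.Computability.AlgebraicComplexity.SymmetricArithCircuit
import Literature.Computability.AlgebraicComplexity.DawarWilsenach2025Proofs
import Literature.GroupTheory.PermutationGroups.SmallIndexSubgroups
import Summits.ValiantsHypothesis.ValiantsHypothesis.Theorems.MonotoneRestorationQP.Negative.LoadBearing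
import Summits.ValiantsHypothesis.ValiantsHypothesis.Theorems.MonotoneRestorationMonotoneRestorationQPPermSupportCount
import Literature.Computability.AlgebraicComplexity.ElementarySymmetricCircuit

/-! TTRL-lite variant V19251 of stmt-ValiantsHypothesis-15886

Target `stub_esymmRowSums_complexity`, move `small_case` (degree ladder, `d = 2`): the second
elementary symmetric polynomial `e_2(R_1, …, R_n)` of the row sums `R_i = Σ_j x_{ij}` of an
`n × n` matrix of variables has complexity at most `(n + 2) ^ 3` in the tree's fan-in-two
(monotone, over `ℝ≥0`) measure `complexity`. The tree's
`Literature.Computability.AlgebraicComplexity.complexity_esymm_rowSums_le`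
(`ElementarySymmetricCircuit.lean`: `n · n` sum gates for the row sums, then the dynamic programme
`e_{t+1}(a ∷ s) = e_{t+1}(s) + a · e_t(s)`, two gates per table entry, shared through
substitution, Bürgisser 2000, Rem. 2.7) gives `L ≤ 2 · 3 · n + n · n`, and
`6 n + n² ≤ (n + 2)³`. (The variant note's formula expansion `Σ_{|t|=2} ∏_{i∈t} R_i`, of cost
`C(n,2)(2n+3)`, would also fit under `(n + 2)³`; the dynamic programme is cheaper and already
in the tree.) -/

-- `Summit.ValiantsHypothesis.ValiantsHypothesis.…` is the tree's mandated single-conjunct layout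
-- (Sub = Summit), so the duplicated namespace component is intended.
set_option linter.dupNamespace false

namespace Summit.ValiantsHypothesis.ValiantsHypothesis.Theorems

open Summit.ValiantsHypothesis.ValiantsHypothesis.Theses.MonotoneRestoration
open Literature.Computability.AlgebraicComplexity

/-- **TTRL-lite variant V19251 of `stub_esymmRowSums_complexity`** (stmt-ValiantsHypothesis-15886,
move `small_case`, degree `d = 2`): over `ℝ≥0` (monotone circuits, fan-in-two measure
`complexity`), the elementary symmetric polynomial `e_2` of the row sums of an `n × n` matrix of
variables has complexity at most `(n + 2) ^ 3`. From the tree's `complexity_esymm_rowSums_le`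
(`L ≤ 2 (2 + 1) n + n · n`: row sums, then the dynamic programme for `e_d` shared through
substitution) and the arithmetic `6 n + n² ≤ (n + 2)³`.
[cite: Burgisser2000, Def. 2.1 / Rem. 2.7] -/
theorem stub_esymmRowSums_complexity_var19251 :
    ∀ n : ℕ, complexity (MvPolynomial.bind₁ (fun i : Fin n => ∑ j : Fin n, MvPolynomial.X (i, j))
      (MvPolynomial.esymm (Fin n) NNReal 2)) ≤ (n + 2) ^ 3 := by
  intro n
  refine (complexity_esymm_rowSums_le (R := NNReal) (ι := Fin n) (κ := Fin n) 2).trans ?_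
  rw [Fintype.card_fin]
  nlinarith [Nat.zero_le n]

end Summit.ValiantsHypothesis.ValiantsHypothesis.Theorems
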